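import Summits.HodgeConjecture.HodgeConjecture.Theorems.F0P3XiPacketFamilyOfRecordSCD     -- ★ the record `xiPacketFamilyOfRecordSCD … hSC ξ v` (S7's `QsRigidCore` currency), `…_of_split`
import Summits.HodgeConjecture.HodgeConjecture.Theorems.F0P3XiPacketFamilyOfRecordGlue    -- ★ `keysOfKeysCaseTwo` (the Keys labels of record, §2's spelling)
import Summits.HodgeConjecture.HodgeConjecture.Theorems.F0P3XiLocalLabelsOfMemXiFamily     -- ★ U♭-loc: `bc_localComponent_eq_of_mem_cmSplitPacket_members` (the split member determines its labels) + ★ `F0P3FinRepConstituentsExist`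
import Summits.HodgeConjecture.HodgeConjecture.Theorems.F0P3cStCharTSCharField             -- ★ `qsForm_map_cmConjRingHom_transpose` : `(σΦ₃)ᵀ = Φ₃` (§2's spelling)
import Summits.HodgeConjecture.HodgeConjecture.Theorems.F0P3cStCharTSShellOrbitalGCan       -- ★ `F0P3cStCharTSShellOrbitalG.isUnit_det_qsForm` (§2's spelling)
import Literature.NumberTheory.Rogawski1990.OneDimAutRepHSplitRigidityOffFinite            -- ★ U♭-glob off a finite set: `OneDimAutRepH.ext_of_exists_bc_localComponent_eq_of_split_of_not_mem`
import HarnessLib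

/-!
# R90-TF · S5 «Ch. 13.3» — THE U♭-VARIANT FOR S7's `QsRigidCore` ROAD: an envelope member `P ∈ env(ξ′)` whose components are a.e. the record members `πⁿ(ξ_v)` has `ξ′ = ξ`
# (`Theorems/R90S5MemXiFamilyUniqOfAEComponents.lean`; Rogawski 1990 §13.1 p. 199 «`Π(ξ)` is indexed by `ξ`», Thm. 13.3.5 p. 202, §14.6 p. 244 «there exists a unique ξ …»)

Cell `hodgecm-mathlib`, crux H413 (`stmt-HodgeConjecture-24833`), route of record `HCCMUnconditional`; programme R90-TF (brief `director/R90-BRIEF.v2.md` 1f40d54518340a35),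
section S5 (base `R90-C133`), seat R90-C133-p03 (g4); S5 dealer R90-C133-plan (g3) DEAL (H34) (R90 bus 2026-09-05T03:41:50Z, answering S7's census D-S7#14
`R90/R90-C146-p01/g2/CENSUS-D-S7-14-QsRigidCorePayerRoad.v1.66450bb62f0f30d4.frozen.md` §2 (P2) ∕ §3 (R-ae)).  PROOF lane (`--supports stmt-HodgeConjecture-24833 --as helper`):
theorems only; no `def`, no instance, no notation, no `sorry`; Lines-free.

THE POINT (census §3, residue (R-ae)).  S7's letter ★ `R90.S7.QsRigidCore L` (Thm. 13.3.6 (c) on `U(Φ₃)`, `Theorems/R90S7RigidCoreDefs.lean` :77–:163) speaks of a family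
`π : ∀ v, IrrClass (U(Φ₃)_v)` OCCURRING in the discrete spectrum (★ `cmOccursInDiscreteSpectrum`: `∃ P σ, … P.HasFinComponent σ ∧ ∀ v c₀, c₀ constituent_v σ ↔ c₀ = π v ∘ e`) with
«`π v = (xiPacketFamilyOfRecordSCD … hSC ξ v).πn` for all but finitely many `v`».  S5's finite trigger (QS-T) yields `MemXiFamily P … ξ′` for SOME `ξ′`; to feed S5's (QS-R♯)
(`MemXiFamily P … ξ` for THE `ξ` of the hypothesis) one needs `ξ′ = ξ`.  ★ U♭ (`R90S5MemXiFamilyRigid`, `F0P3XiRigid`) compares TWO envelopes of one `P`; THIS file compares ONE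
envelope with the A.E. RECORD STRING — the U♭-variant — by the SAME two halves as U♭ of record, read at the SPLIT places outside the exceptional finite set:
LOCAL — at a split `v` the record packet is the D6 split packet at the fixed witness `w = splitWitness v hs` (★ `xiPacketFamilyOfRecordSCD_of_split`), a SINGLETON, and the
ξ′-family is the ξ′-split packet at the same `w` (★ `IsXiLocalFamily`, ed. 2 split clause); the component `π v` lies in both, so the Zelevinsky labels give `η̃_w = η̃′_w`,
`ψ̃_w = ψ̃′_w` (★ `bc_localComponent_eq_of_mem_cmSplitPacket_members`); GLOBAL — automorphic characters of `U(1)_{L∕L⁺}` agreeing at one place above every split `v` OFF A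
FINITE SET are equal (★ `OneDimAutRepH.ext_of_exists_bc_localComponent_eq_of_split_of_not_mem`, weak approximation; no trace formula).  The non-split places are not
used (their `πⁿ(ξ_v)` carries `ξ_v` too, but the split half is what the tree's U♭ road proves).
* §1 (any hermitian `H`, any record data `μZ, keys, hSC`): `xi_eq_of_memXiFamily_of_eventually_eq_recordSCD_πn` and the re-labelling corollary
  `memXiFamily_of_memXiFamily_of_eventually_eq_recordSCD_πn` («a.e. `πⁿ(ξ_v)` + SOME envelope ⇒ THE ξ-envelope»).
* §2 (S7's spelling, `H := qsForm L`, `hH := F0P3cStCharTSCharField.qsForm_map_cmConjRingHom_transpose L`, `hHd := F0P3cStCharTSShellOrbitalG.isUnit_det_qsForm L`,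
  `keys := keysOfKeysCaseTwo L μω hK μZ hquad` — the record term of `QsRigidCore` :158–:159 TOKEN FOR TOKEN): `xi_eq_of_memXiFamily_of_eventually_eq_qsRecordSCD_πn`,
  `memXiFamily_of_memXiFamily_of_eventually_eq_qsRecordSCD_πn` — the shape S7's junction `qsRigidCore_of_S5` (census §3, JQ-S7-C1) consumes after destructuring
  `cmOccursInDiscreteSpectrum` (★ `cmOccursInDiscreteSpectrum_iff`) and (QS-T).
HONEST LABEL: helpers; close no socket ((R-ae)'s print content is (QS-T) `stub_R90_1336c_qsFinMembership`, (R-rig) is `stub_R90_1335_qsXiRigiditySharp`); REL ≠ ★ ≠ BUILT;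
HC_CM is proved only modulo the 7 printed citations (2 remaining named inputs: hLiu418 = stmt-HodgeConjecture-24832, h413 = stmt-HodgeConjecture-24833) until rung 0 closes.
[cite: Rogawski1990, §13.1 p. 199; §12.2 pp. 173–174; Thm. 13.3.5 p. 202; §14.6 p. 244; §4.13 Lemma 4.13.1 (b) pp. 64–66] [cite: Zelevinsky1980, Thm. 4.2]
[cite: CasselsFrohlichANT1967, Ch. VII §4 Prop. 4.1] [cite: PlatonovRapinchuk1994, §7.3 Prop. 7.8]
-/

set_option autoImplicit false
-- the mandated namespace repeats the single-problem summit's segment (`HodgeConjecture.HodgeConjecture`)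
set_option linter.dupNamespace false

noncomputable section

open NumberField IsDedekindDomain MeasureTheory Filter
open scoped Matrix
open Literature.NumberTheory Literature.NumberTheory.Automorphic Literature.NumberTheory.Automorphic.UnitaryGroup
open Literature.NumberTheory.Rogawski1990 Literature.NumberTheory.GaloisRepresentations

namespace Summit.HodgeConjecture.HodgeConjecture.R90.S5

open Summit.HodgeConjecture.HodgeConjecture.Cruxes.H413
open Summit.HodgeConjecture.HodgeConjecture.Cruxes.H413.F0P3XiPacketFamilyOfRecord (keysOfKeysCaseTwo)
open Summit.HodgeConjecture.HodgeConjecture.Cruxes.H413.F0P3XiPacketFamilyOfRecordSCD (xiPacketFamilyOfRecordSCD xiPacketFamilyOfRecordSCD_of_split)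
open Summit.HodgeConjecture.HodgeConjecture.Cruxes.H413.F0P3XiLocalLabelsOfMemXiFamily (bc_localComponent_eq_of_mem_cmSplitPacket_members)
open Summit.HodgeConjecture.HodgeConjecture.Cruxes.H413.F0P3FinRepConstituentsExist (isConstituentOf_finRepSmooth_comp_of_hasFinComponent)

/-! ## §1 Any hermitian `H`, any record data: ONE envelope against the a.e. record string -/

section General

variable (L : Type) [Field L] [NumberField L] [IsCMField L] (H : Matrix (Fin 3) (Fin 3) L)
  (hH : (H.map (cmConjRingHom L))ᵀ = H) (hHd : IsUnit H.det) (μω : HeckeCharacter L) (hμu : μω.IsUnitary)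
  -- the record's data (★ `F0P3XiPacketFamilyOfRecordSCD` §1 binders VERBATIM): Haar data mod centre, Keys labels, supercuspidal-partner datum
  [∀ v : HeightOneSpectrum (𝓞 ↥(maximalRealSubfield L)), MeasurableSpace (Gqs L v ⧸ Subgroup.center (Gqs L v))]
  (μZ : ∀ v : HeightOneSpectrum (𝓞 ↥(maximalRealSubfield L)), Measure (Gqs L v ⧸ Subgroup.center (Gqs L v)))
  (keys : ∀ (ξ : OneDimAutRepH L) (v : HeightOneSpectrum (𝓞 ↥(maximalRealSubfield L))),
    (∀ w : PlacesOver L v, IsCMField.complexConj L • w.1 = w.1) →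
      {p : IrrClass (Gqs L v) × IrrClass (Gqs L v) //
        KeysCaseTwoLabels L v (μω.semilocalComponent L v) (torusLocalComponent L (IsCMField.complexConj L) v ξ.η)
          (torusLocalComponent L (IsCMField.complexConj L) v ξ.ψ) p.1 p.2 ∧
        p.1.IsSquareIntegrable (μZ v) ∧ ¬ p.2.IsSquareIntegrable (μZ v)})
  (hSC : ∀ (ξ : OneDimAutRepH L) (v : HeightOneSpectrum (𝓞 ↥(maximalRealSubfield L)))
    (hns : ∀ w : PlacesOver L v, IsCMField.complexConj L • w.1 = w.1)
    (T : GL (Fin 3) (LocalRing L v)) (a : LocalRing L v) (ha : IsUnit a)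
    (h : formCongr (conjLocal L (IsCMField.complexConj L) v) T (H.map (algebraMap L (LocalRing L v))) =
      a • (Matrix.of fun i j : Fin 3 => if i.val + j.val + 1 = 3 then (1 : L) else 0).map (algebraMap L (LocalRing L v)))
    (π2 πn : IrrClass (Gqs L v)),
    KeysCaseTwoLabels L v (μω.semilocalComponent L v) (torusLocalComponent L (IsCMField.complexConj L) v ξ.η)
      (torusLocalComponent L (IsCMField.complexConj L) v ξ.ψ) π2 πn → ¬ πn.IsSquareIntegrable (μZ v) →
    {πs : IrrClass ((cmDatum L 3 H).Local v) // πs.IsSupercuspidal ∧ πs ≠ IrrClass.comap (cmDatumLocalCongr L v T ha h).symm πn})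
  {μ : Measure (adelicGroupData (↥(maximalRealSubfield L)) L (IsCMField.complexConj L) 3 H).automorphicQuotient}
  [(adelicGroupData (↥(maximalRealSubfield L)) L (IsCMField.complexConj L) 3 H).IsAutomorphicMeasure μ]

/-- **THE U♭-VARIANT: ONE ENVELOPE AGAINST THE A.E. RECORD STRING.**  Let `P` be a discrete automorphic representation of `U(H)` with an irreducible smooth finite component
`σ` (★ `HasFinComponent`), let `π = (π_v)_v` be THE family of local classes of `σ` (the clause of ★ `cmOccursInDiscreteSpectrum`: `c₀ constituent_v σ ↔ c₀ = π v ∘ e`), and let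
`ξ, ξ′` be one-dimensional automorphic representations of `H = U(2) × U(1)`.  If `P` lies in the ξ′-envelope (`MemXiFamily P … μω hμu ξ′`) and `π v = (record ξ v).πn` for
all but finitely many finite `v` (the hypothesis of S7's `QsRigidCore`, ★ `xiPacketFamilyOfRecordSCD`), then `ξ′ = ξ`.  Proof: at every SPLIT `v` outside the exceptional set,
`π v` is a constituent of `P` at `v` (★ `isConstituentOf_finRepSmooth_comp_of_hasFinComponent`), hence lies in the ξ′-split packet at `w = splitWitness v hs` (★ `IsXiLocalFamily`,
`LocalConstituentsIn`), and it IS the member of the ξ-split packet at the same `w` (★ `xiPacketFamilyOfRecordSCD_of_split`); so `η̃_w, ψ̃_w` agree (★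
`bc_localComponent_eq_of_mem_cmSplitPacket_members`) and weak approximation off the finite set (★ `OneDimAutRepH.ext_of_exists_bc_localComponent_eq_of_split_of_not_mem`) gives
`ξ′ = ξ`. [cite: Rogawski1990, §13.1 p. 199; §12.2 pp. 173–174; Thm. 13.3.5 p. 202; §14.6 p. 244; §4.13 Lemma 4.13.1 (b) pp. 64–66] [cite: Zelevinsky1980, Thm. 4.2]
[cite: CasselsFrohlichANT1967, Ch. VII §4 Prop. 4.1] [cite: PlatonovRapinchuk1994, §7.3 Prop. 7.8] -/
theorem xi_eq_of_memXiFamily_of_eventually_eq_recordSCD_πn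
    (P : DiscreteAutomorphicRep (adelicGroupData (↥(maximalRealSubfield L)) L (IsCMField.complexConj L) 3 H) μ)
    {W : Type} [AddCommGroup W] [Module ℂ W]
    {σ : Representation ℂ (finAdelic (↥(maximalRealSubfield L)) L (IsCMField.complexConj L) 3 H) W}
    (hsm : σ.IsSmooth) (hPσ : P.HasFinComponent σ)
    (π : ∀ v : HeightOneSpectrum (𝓞 ↥(maximalRealSubfield L)), IrrClass ((cmDatum L 3 H).Local v))
    (hπ : ∀ (v : HeightOneSpectrum (𝓞 ↥(maximalRealSubfield L))) (c₀ : IrrClass (localPi L (IsCMField.complexConj L) 3 H v)),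
      c₀.IsConstituentOf (σ.comp (inclPlace (↥(maximalRealSubfield L)) L (IsCMField.complexConj L) 3 H v)) ↔
        c₀ = IrrClass.comap (localPiEquiv L (IsCMField.complexConj L) 3 H v) (π v))
    (ξ ξ' : OneDimAutRepH L) (hmem : MemXiFamily P hH hHd μω hμu ξ')
    (h : ∀ᶠ v : HeightOneSpectrum (𝓞 ↥(maximalRealSubfield L)) in cofinite,
      π v = (xiPacketFamilyOfRecordSCD L H hH hHd μω hμu μZ keys hSC ξ v).πn) :
    ξ' = ξ := by
  obtain ⟨Pv', hfam', hcons'⟩ := hmem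
  have hfin := Filter.eventually_cofinite.1 h
  refine OneDimAutRepH.ext_of_exists_bc_localComponent_eq_of_split_of_not_mem hfin.toFinset fun v hv hs => ?_
  -- `v ∉` the exceptional set: the a.e. hypothesis holds at `v`
  have hv' : π v = (xiPacketFamilyOfRecordSCD L H hH hHd μω hμu μZ keys hSC ξ v).πn := by
    by_contra hne
    exact hv (hfin.mem_toFinset.2 hne)
  -- `π v` is a constituent of `P` at `v` (smooth-part currency), through `σ`
  have hc : (IrrClass.comap (localPiEquiv L (IsCMField.complexConj L) 3 H v) (π v)).IsConstituentOf
      (P.finRep.smoothPart.toRepresentation.comp (inclPlace (↥(maximalRealSubfield L)) L (IsCMField.complexConj L) 3 H v)) :=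
    isConstituentOf_finRepSmooth_comp_of_hasFinComponent P hsm hPσ ((hπ v _).2 rfl)
  -- hence in the ξ′-family's packet at `v`, which at the split `v` IS the ξ′-split packet at `w = splitWitness v hs`
  have h₂ := hcons' v (π v) hc
  rw [hfam'.1 v hs] at h₂
  -- and it IS the member of the record packet of `ξ` at `v` = the ξ-split packet at the same `w`
  have h₁ : π v ∈ (cmSplitPacket L H hH hHd v (splitWitness v hs) (splitWitness_spec v hs) (ξ.splitν₀ μω (splitWitness v hs).1)
      (ξ.locψ (splitWitness v hs).1) (ξ.norm_splitν₀_apply hμu (splitWitness v hs).1)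
      (ξ.continuous_splitν₀ μω (splitWitness v hs).1) (ξ.norm_locψ_apply (splitWitness v hs).1)
      (ξ.continuous_locψ (splitWitness v hs).1)).members := by
    rw [← xiPacketFamilyOfRecordSCD_of_split L H hH hHd μω hμu μZ keys hSC ξ v hs, LocalAPacket.mem_members_iff]
    exact Or.inl hv'
  exact ⟨splitWitness v hs, bc_localComponent_eq_of_mem_cmSplitPacket_members hH hHd (splitWitness v hs) (splitWitness_spec v hs) ξ' ξ μω hμu h₂ h₁⟩

/-- **RE-LABELLING COROLLARY («a.e. `πⁿ(ξ_v)` + SOME envelope ⇒ THE ξ-envelope»)**: under the hypotheses of `xi_eq_of_memXiFamily_of_eventually_eq_recordSCD_πn`,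
`MemXiFamily P … ξ`.  With S5's finite trigger (QS-T) (which produces SOME `ξ′`) this is census D-S7#14's residue (R-ae) in the ★ part.
[cite: Rogawski1990, Thm. 13.3.5 p. 202; §14.6 p. 244] -/
theorem memXiFamily_of_memXiFamily_of_eventually_eq_recordSCD_πn
    (P : DiscreteAutomorphicRep (adelicGroupData (↥(maximalRealSubfield L)) L (IsCMField.complexConj L) 3 H) μ)
    {W : Type} [AddCommGroup W] [Module ℂ W]
    {σ : Representation ℂ (finAdelic (↥(maximalRealSubfield L)) L (IsCMField.complexConj L) 3 H) W}
    (hsm : σ.IsSmooth) (hPσ : P.HasFinComponent σ)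
    (π : ∀ v : HeightOneSpectrum (𝓞 ↥(maximalRealSubfield L)), IrrClass ((cmDatum L 3 H).Local v))
    (hπ : ∀ (v : HeightOneSpectrum (𝓞 ↥(maximalRealSubfield L))) (c₀ : IrrClass (localPi L (IsCMField.complexConj L) 3 H v)),
      c₀.IsConstituentOf (σ.comp (inclPlace (↥(maximalRealSubfield L)) L (IsCMField.complexConj L) 3 H v)) ↔
        c₀ = IrrClass.comap (localPiEquiv L (IsCMField.complexConj L) 3 H v) (π v))
    (ξ ξ' : OneDimAutRepH L) (hmem : MemXiFamily P hH hHd μω hμu ξ')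
    (h : ∀ᶠ v : HeightOneSpectrum (𝓞 ↥(maximalRealSubfield L)) in cofinite,
      π v = (xiPacketFamilyOfRecordSCD L H hH hHd μω hμu μZ keys hSC ξ v).πn) :
    MemXiFamily P hH hHd μω hμu ξ :=
  xi_eq_of_memXiFamily_of_eventually_eq_recordSCD_πn L H hH hHd μω hμu μZ keys hSC P hsm hPσ π hπ ξ ξ' hmem h ▸ hmem

end General

/-! ## §2 S7's spelling: the quasi-split `U(Φ₃)`, Keys labels of record, `QsRigidCore`'s record term token for token -/

section QuasiSplit

variable (L : Type) [Field L] [NumberField L] [IsCMField L] (μω : HeckeCharacter L) (hμu : μω.IsUnitary)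
  [∀ v : HeightOneSpectrum (𝓞 ↥(maximalRealSubfield L)), MeasurableSpace (Gqs L v ⧸ Subgroup.center (Gqs L v))]
  [∀ v : HeightOneSpectrum (𝓞 ↥(maximalRealSubfield L)), BorelSpace (Gqs L v ⧸ Subgroup.center (Gqs L v))]
  (μZ : ∀ v : HeightOneSpectrum (𝓞 ↥(maximalRealSubfield L)), Measure (Gqs L v ⧸ Subgroup.center (Gqs L v)))
  [∀ v : HeightOneSpectrum (𝓞 ↥(maximalRealSubfield L)), (μZ v).IsHaarMeasure]
  (hK : KeysCaseTwo L)
  (hquad : ∀ v : HeightOneSpectrum (𝓞 ↥(maximalRealSubfield L)), (∀ w : PlacesOver L v, IsCMField.complexConj L • w.1 = w.1) →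
    IsQuadraticCharExtension (conjLocal L (IsCMField.complexConj L) v) (μω.semilocalComponent L v))
  (hSC : ∀ (ξ : OneDimAutRepH L) (v : HeightOneSpectrum (𝓞 ↥(maximalRealSubfield L)))
    (hns : ∀ w : PlacesOver L v, IsCMField.complexConj L • w.1 = w.1)
    (T : GL (Fin 3) (LocalRing L v)) (a : LocalRing L v) (ha : IsUnit a)
    (h : formCongr (conjLocal L (IsCMField.complexConj L) v) T ((qsForm L).map (algebraMap L (LocalRing L v))) =
      a • (Matrix.of fun i j : Fin 3 => if i.val + j.val + 1 = 3 then (1 : L) else 0).map (algebraMap L (LocalRing L v)))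
    (π2 πn : IrrClass (Gqs L v)),
    KeysCaseTwoLabels L v (μω.semilocalComponent L v) (torusLocalComponent L (IsCMField.complexConj L) v ξ.η)
      (torusLocalComponent L (IsCMField.complexConj L) v ξ.ψ) π2 πn → ¬ πn.IsSquareIntegrable (μZ v) →
    {πs : IrrClass ((cmDatum L 3 (qsForm L)).Local v) // πs.IsSupercuspidal ∧ πs ≠ IrrClass.comap (cmDatumLocalCongr L v T ha h).symm πn})
  {μG : Measure (adelicGroupData (↥(maximalRealSubfield L)) L (IsCMField.complexConj L) 3 (qsForm L)).automorphicQuotient}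
  [(adelicGroupData (↥(maximalRealSubfield L)) L (IsCMField.complexConj L) 3 (qsForm L)).IsAutomorphicMeasure μG]

/-- **THE U♭-VARIANT IN S7's SPELLING** (`QsRigidCore L`, ★ `R90S7RigidCoreDefs` :77–:163): on the quasi-split `U(Φ₃)` with `hH := qsForm_map_cmConjRingHom_transpose L`,
`hHd := isUnit_det_qsForm L`, the Keys labels of record `keysOfKeysCaseTwo L μω hK μZ hquad` and an arbitrary supercuspidal-partner datum `hSC`: a discrete `P` of `U(Φ₃)`
with irreducible smooth finite component `σ` whose family of local classes `π` (the ★ `cmOccursInDiscreteSpectrum` clause) equals the record member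
`(xiPacketFamilyOfRecordSCD L (qsForm L) … hSC ξ v).πn` for all but finitely many `v`, and which lies in the ξ′-envelope, has `ξ′ = ξ`.
[cite: Rogawski1990, §13.1 p. 199; Thm. 13.3.5 p. 202; Thm. 13.3.6 (c) p. 202; §14.6 p. 244] [cite: Zelevinsky1980, Thm. 4.2] [cite: CasselsFrohlichANT1967, Ch. VII §4 Prop. 4.1] -/
theorem xi_eq_of_memXiFamily_of_eventually_eq_qsRecordSCD_πn
    (P : DiscreteAutomorphicRep (adelicGroupData (↥(maximalRealSubfield L)) L (IsCMField.complexConj L) 3 (qsForm L)) μG)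
    {W : Type} [AddCommGroup W] [Module ℂ W]
    {σ : Representation ℂ (finAdelic (↥(maximalRealSubfield L)) L (IsCMField.complexConj L) 3 (qsForm L)) W}
    (hsm : σ.IsSmooth) (hPσ : P.HasFinComponent σ)
    (π : ∀ v : HeightOneSpectrum (𝓞 ↥(maximalRealSubfield L)), IrrClass ((cmDatum L 3 (qsForm L)).Local v))
    (hπ : ∀ (v : HeightOneSpectrum (𝓞 ↥(maximalRealSubfield L))) (c₀ : IrrClass (localPi L (IsCMField.complexConj L) 3 (qsForm L) v)),
      c₀.IsConstituentOf (σ.comp (inclPlace (↥(maximalRealSubfield L)) L (IsCMField.complexConj L) 3 (qsForm L) v)) ↔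
        c₀ = IrrClass.comap (localPiEquiv L (IsCMField.complexConj L) 3 (qsForm L) v) (π v))
    (ξ ξ' : OneDimAutRepH L)
    (hmem : MemXiFamily P (F0P3cStCharTSCharField.qsForm_map_cmConjRingHom_transpose L) (F0P3cStCharTSShellOrbitalG.isUnit_det_qsForm L) μω hμu ξ')
    (h : ∀ᶠ v : HeightOneSpectrum (𝓞 ↥(maximalRealSubfield L)) in cofinite,
      π v = (xiPacketFamilyOfRecordSCD L (qsForm L) (F0P3cStCharTSCharField.qsForm_map_cmConjRingHom_transpose L)
        (F0P3cStCharTSShellOrbitalG.isUnit_det_qsForm L) μω hμu μZ (keysOfKeysCaseTwo L μω hK μZ hquad) hSC ξ v).πn) :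
    ξ' = ξ :=
  xi_eq_of_memXiFamily_of_eventually_eq_recordSCD_πn L (qsForm L) (F0P3cStCharTSCharField.qsForm_map_cmConjRingHom_transpose L)
    (F0P3cStCharTSShellOrbitalG.isUnit_det_qsForm L) μω hμu μZ (keysOfKeysCaseTwo L μω hK μZ hquad) hSC P hsm hPσ π hπ ξ ξ' hmem h

/-- **RE-LABELLING COROLLARY IN S7's SPELLING**: same hypotheses ⇒ `MemXiFamily P … ξ` (the envelope of THE `ξ` of `QsRigidCore`'s hypothesis) — the input of S5's (QS-R♯)
`stub_R90_1335_qsXiRigiditySharp` on S7's junction road `qsRigidCore_of_S5` (census D-S7#14 §3). [cite: Rogawski1990, Thm. 13.3.5 p. 202; Thm. 13.3.6 (c) p. 202; §14.6 p. 244] -/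
theorem memXiFamily_of_memXiFamily_of_eventually_eq_qsRecordSCD_πn
    (P : DiscreteAutomorphicRep (adelicGroupData (↥(maximalRealSubfield L)) L (IsCMField.complexConj L) 3 (qsForm L)) μG)
    {W : Type} [AddCommGroup W] [Module ℂ W]
    {σ : Representation ℂ (finAdelic (↥(maximalRealSubfield L)) L (IsCMField.complexConj L) 3 (qsForm L)) W}
    (hsm : σ.IsSmooth) (hPσ : P.HasFinComponent σ)
    (π : ∀ v : HeightOneSpectrum (𝓞 ↥(maximalRealSubfield L)), IrrClass ((cmDatum L 3 (qsForm L)).Local v))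
    (hπ : ∀ (v : HeightOneSpectrum (𝓞 ↥(maximalRealSubfield L))) (c₀ : IrrClass (localPi L (IsCMField.complexConj L) 3 (qsForm L) v)),
      c₀.IsConstituentOf (σ.comp (inclPlace (↥(maximalRealSubfield L)) L (IsCMField.complexConj L) 3 (qsForm L) v)) ↔
        c₀ = IrrClass.comap (localPiEquiv L (IsCMField.complexConj L) 3 (qsForm L) v) (π v))
    (ξ ξ' : OneDimAutRepH L)
    (hmem : MemXiFamily P (F0P3cStCharTSCharField.qsForm_map_cmConjRingHom_transpose L) (F0P3cStCharTSShellOrbitalG.isUnit_det_qsForm L) μω hμu ξ')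
    (h : ∀ᶠ v : HeightOneSpectrum (𝓞 ↥(maximalRealSubfield L)) in cofinite,
      π v = (xiPacketFamilyOfRecordSCD L (qsForm L) (F0P3cStCharTSCharField.qsForm_map_cmConjRingHom_transpose L)
        (F0P3cStCharTSShellOrbitalG.isUnit_det_qsForm L) μω hμu μZ (keysOfKeysCaseTwo L μω hK μZ hquad) hSC ξ v).πn) :
    MemXiFamily P (F0P3cStCharTSCharField.qsForm_map_cmConjRingHom_transpose L) (F0P3cStCharTSShellOrbitalG.isUnit_det_qsForm L) μω hμu ξ :=
  xi_eq_of_memXiFamily_of_eventually_eq_qsRecordSCD_πn L μω hμu μZ hK hquad hSC P hsm hPσ π hπ ξ ξ' hmem h ▸ hmem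

end QuasiSplit

end Summit.HodgeConjecture.HodgeConjecture.R90.S5

end
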